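import Mathlib
import HarnessLib
import Summits.HubbardSuperconductivity.HubbardSuperconductivity.Theorems.KLProgrammeKLRegimeSplitGlueP3
import Summits.HubbardSuperconductivity.HubbardSuperconductivity.Theorems.KLProgrammeKLRegimeSplitGlueP4
import Summits.HubbardSuperconductivity.HubbardSuperconductivity.Theorems.KLProgrammeKLRegimeSplitBundleV9

/-!
# Route `KLProgramme` — the K3-NAMED glue of the five gen-3 children at the bundle `klPredsV9` (Δ16 count repair + Δ18 angular clause), v4 staging
# (`EngineP4` / `VolumeLimitP2`, Δ17 thresholds; p1's `…SplitGlueP4`) and, for completeness, v3 staging (stmt-HubbardSuperconductivity-19937;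
# DOWNSTREAM of the route file; cell gate-hubbard-kl, seat hubbard-kl-k3c2-p3; plan g10 ruling 2026-08-26T17:26:06Z (3))

`KLRegimeInductionV9P4 := KLRegimeInductionP4 klPredsV9 FinalTwoLegVolLimit` — the closer the gen-3 resplit's glue item `KLRegimeTwoPointLimitGlueV9` cites
(`--workitem` by whoever once the id exists); `KLRegimeInductionV9P3`, `KLRegimeInductionV9P4_of_P3` harmless extras.  Nothing else is asserted.
-/

noncomputable section

namespace Summit.HubbardSuperconductivity.HubbardSuperconductivity.Theorems.KLRegimeSplit

set_option linter.dupNamespace false -- summit = problem name (single-conjunct summit), D-0017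

/-- **The K3-named glue at `klPredsV9`, v4 staging**: `EngineP4 klPredsV9 klWindowC`, `BetaSplitP klPredsV9 klWindowC`, `CountertermP2 klPredsV9 klWindowC`,
`VolumeLimitP2 klPredsV9 FinalTwoLegVolLimit klWindowC`, `TwoPointAssemblyP3 klPredsV9 FinalTwoLegVolLimit klWindowC` imply crux K3 `KLRegimeTwoPointLimit`
BY NAME. -/
theorem KLRegimeInductionV9P4 :
    EngineP4 klPredsV9 klWindowC → BetaSplitP klPredsV9 klWindowC → CountertermP2 klPredsV9 klWindowC →
      VolumeLimitP2 klPredsV9 FinalTwoLegVolLimit klWindowC → TwoPointAssemblyP3 klPredsV9 FinalTwoLegVolLimit klWindowC →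
        Summit.HubbardSuperconductivity.HubbardSuperconductivity.Theses.KLProgramme.KLRegimeTwoPointLimit :=
  KLRegimeInductionP4 klPredsV9 FinalTwoLegVolLimit

/-- **The K3-named glue at `klPredsV9`, v3 staging** (`EngineP3` / `VolumeLimitP`). -/
theorem KLRegimeInductionV9P3 :
    EngineP3 klPredsV9 klWindowC → BetaSplitP klPredsV9 klWindowC → CountertermP2 klPredsV9 klWindowC →
      VolumeLimitP klPredsV9 FinalTwoLegVolLimit klWindowC → TwoPointAssemblyP3 klPredsV9 FinalTwoLegVolLimit klWindowC →
        Summit.HubbardSuperconductivity.HubbardSuperconductivity.Theses.KLProgramme.KLRegimeTwoPointLimit :=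
  KLRegimeInductionP3 klPredsV9 FinalTwoLegVolLimit

/-- The v3 five-tuple at `klPredsV9` also closes K3 through the v4 glue. -/
theorem KLRegimeInductionV9P4_of_P3 :
    EngineP3 klPredsV9 klWindowC → BetaSplitP klPredsV9 klWindowC → CountertermP2 klPredsV9 klWindowC →
      VolumeLimitP klPredsV9 FinalTwoLegVolLimit klWindowC → TwoPointAssemblyP3 klPredsV9 FinalTwoLegVolLimit klWindowC →
        Summit.HubbardSuperconductivity.HubbardSuperconductivity.Theses.KLProgramme.KLRegimeTwoPointLimit :=
  fun h₃ h₁ h₂ h₅ h₄ => KLRegimeInductionV9P4 (engineP4_of_engineP3 h₃) h₁ h₂ (volumeLimitP2_of_volumeLimitP h₅) h₄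

end Summit.HubbardSuperconductivity.HubbardSuperconductivity.Theorems.KLRegimeSplit

end
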